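import Literature.RingTheory.HilbertSamuel.HilbertFunctionsNoetherian
import Literature.RingTheory.MvPolynomial.HomogeneousHilbertFunction
import Mathlib.Algebra.MvPolynomial.Equiv
import Mathlib.RingTheory.Polynomial.Basic
import HarnessLib

/-!
# The Hilbert function of a polynomial extension: `H(A[T]) = H^{(1)}(A)`
# (Cossart–Jannsen–Saito 2020, Lemma 2.27 (2) / (2.6), Rem. 2.9 (c))

Topic: `Literature/RingTheory/MvPolynomial`. For a standard graded algebra `A = S/I`,
`S = k[X_1, …, X_n]`, the graded algebra `A[T] = S'/I S'`, `S' = k[X_0, X_1, …, X_n]` (the new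
variable in front, `S ↪ S'` being `rename Fin.succ`), has graded pieces
`(A[T])_d = ⊕_{j ≤ d} A_{d-j} T^j`, so that its Hilbert function is the first sum function of that
of `A`: **`H(A[T])(d) = Σ_{i ≤ d} H(A)(i) = H^{(1)}(A)(d)`**. This is the graded computation behind
CJS Lemma 2.27 (2), (2.6): `gr_{𝔪'}(𝒪_{X',x'}) ≅ gr_𝔪(𝒪_{X,x}) ⊗_{k(x)} k(x')[T_1, …, T_d]`, whence
`H^{(0)}(𝒪_{X',x'}) = H^{(d)}(𝒪_{X,x})` (Lemma 2.37 (1)), and behind Rem. 2.9 (c). PROVED: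

* `finSuccEquiv_rename_succ` — `S ↪ S' ≅ S[X_0]` is `Polynomial.C`;
* **`mem_map_rename_succ_iff`** — `f ∈ I S' ↔` all `X_0`-coefficients of `f` lie in `I`;
* the `X_0`-coefficients `0, …, d` identify `S'_d ≅ Π_j S_{d-j}` and `(I S')_d ≅ Π_j I_{d-j}`
  (`finrank_homogeneousSubmodule_succ_eq_sum`, `finrank_idealDegree_map_rename_succ_eq_sum`);
* **`hilbertFunQuot_map_rename_succ`** — **`H(S'/I S')(d) = Σ_{i ≤ d} H(S/I)(i)`**.

## References

* V. Cossart, U. Jannsen, S. Saito, *Desingularization: Invariants and Strategy*, LNM 2270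
  (2020), Ch. 2, Lemma 2.27 (2) with (2.6), Lemma 2.37 (1), Rem. 2.9 (c). [CossartJannsenSaito2020]
-/

noncomputable section

open MvPolynomial Module
open Literature.RingTheory.HilbertSamuel

namespace Literature.RingTheory.MvPolynomial

variable {K : Type*} [Field K] {n : ℕ}

/-! ## `S ↪ S' ≅ S[X_0]` and the extended ideal -/

/-- Under `S' = k[X_0, …, X_n] ≅ S[X_0]`, the inclusion `S ↪ S'` (`X_i ↦ X_{i+1}`) becomes
`Polynomial.C`. [folklore] -/
theorem finSuccEquiv_rename_succ (g : MvPolynomial (Fin n) K) :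
    finSuccEquiv K n (rename Fin.succ g) = Polynomial.C g := by
  have h : ((finSuccEquiv K n : MvPolynomial (Fin (n + 1)) K →ₐ[K] Polynomial (MvPolynomial (Fin n) K)).comp
      (rename Fin.succ)) = (Polynomial.CAlgHom : MvPolynomial (Fin n) K →ₐ[K] Polynomial (MvPolynomial (Fin n) K)) := by
    refine MvPolynomial.algHom_ext fun i => ?_
    rw [AlgHom.comp_apply, rename_X]
    change finSuccEquiv K n (X i.succ) = Polynomial.C (X i)
    exact finSuccEquiv_X_succ
  exact congrArg (fun φ : MvPolynomial (Fin n) K →ₐ[K] Polynomial (MvPolynomial (Fin n) K) => φ g) h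

/-- As ring homomorphisms, `S ↪ S'` is `(S' ≅ S[X_0])⁻¹ ∘ C`. [folklore] -/
theorem coe_rename_succ_eq :
    ((rename Fin.succ : MvPolynomial (Fin n) K →ₐ[K] MvPolynomial (Fin (n + 1)) K) :
      MvPolynomial (Fin n) K →+* MvPolynomial (Fin (n + 1)) K) =
      ((finSuccEquiv K n).symm : Polynomial (MvPolynomial (Fin n) K) →+* MvPolynomial (Fin (n + 1)) K).comp
        Polynomial.C := by
  refine RingHom.ext fun g => ?_
  rw [RingHom.comp_apply]
  apply (finSuccEquiv K n).injective
  rw [RingHom.coe_coe, RingHom.coe_coe, AlgEquiv.apply_symm_apply]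
  exact finSuccEquiv_rename_succ g

/-- **`f ∈ I S' ↔` every `X_0`-coefficient of `f` lies in `I`.** [folklore] -/
theorem mem_map_rename_succ_iff (I : Ideal (MvPolynomial (Fin n) K)) (f : MvPolynomial (Fin (n + 1)) K) :
    f ∈ I.map ((rename Fin.succ : MvPolynomial (Fin n) K →ₐ[K] MvPolynomial (Fin (n + 1)) K) :
      MvPolynomial (Fin n) K →+* MvPolynomial (Fin (n + 1)) K) ↔
      ∀ j : ℕ, (finSuccEquiv K n f).coeff j ∈ I := by
  rw [← Ideal.mem_map_C_iff]
  constructor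
  · intro hf
    have hle : I.map ((rename Fin.succ : MvPolynomial (Fin n) K →ₐ[K] MvPolynomial (Fin (n + 1)) K) :
      MvPolynomial (Fin n) K →+* MvPolynomial (Fin (n + 1)) K) ≤
        (I.map (Polynomial.C : MvPolynomial (Fin n) K →+* Polynomial (MvPolynomial (Fin n) K))).comap
          (finSuccEquiv K n : MvPolynomial (Fin (n + 1)) K →+* Polynomial (MvPolynomial (Fin n) K)) := by
      rw [Ideal.map_le_iff_le_comap]
      intro g hg
      rw [Ideal.mem_comap, Ideal.mem_comap, RingHom.coe_coe, RingHom.coe_coe, finSuccEquiv_rename_succ]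
      exact Ideal.mem_map_of_mem _ hg
    exact hle hf
  · intro hf
    have h := Ideal.mem_map_of_mem
      ((finSuccEquiv K n).symm : Polynomial (MvPolynomial (Fin n) K) →+* MvPolynomial (Fin (n + 1)) K) hf
    rw [RingHom.coe_coe, AlgEquiv.symm_apply_apply, Ideal.map_map, ← coe_rename_succ_eq] at h
    exact h

/-! ## The `X_0`-coefficients of forms -/

/-- The coefficients of a form of degree `d` are forms of degree `d - j`. [folklore] -/
theorem isHomogeneous_coeff_finSuccEquiv {f : MvPolynomial (Fin (n + 1)) K} {d : ℕ} (hf : f.IsHomogeneous d)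
    {j : ℕ} (hj : j ≤ d) : ((finSuccEquiv K n f).coeff j).IsHomogeneous (d - j) :=
  hf.finSuccEquiv_coeff_isHomogeneous j (d - j) (by omega)

/-- The coefficients of a form of degree `d` vanish beyond `d`. [folklore] -/
theorem coeff_finSuccEquiv_eq_zero_of_lt {f : MvPolynomial (Fin (n + 1)) K} {d : ℕ} (hf : f.IsHomogeneous d)
    {j : ℕ} (hj : d < j) : (finSuccEquiv K n f).coeff j = 0 := by
  by_cases hf0 : f = 0
  · rw [hf0, map_zero, Polynomial.coeff_zero]
  refine Polynomial.coeff_eq_zero_of_natDegree_lt ?_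
  rw [natDegree_finSuccEquiv]
  exact (degreeOf_le_totalDegree f 0).trans_lt (by rw [hf.totalDegree hf0]; exact hj)

/-- **A form of degree `d` is determined by its coefficients `0, …, d`.** [folklore] -/
theorem eq_zero_of_coeff_finSuccEquiv_eq_zero {f : MvPolynomial (Fin (n + 1)) K} {d : ℕ} (hf : f.IsHomogeneous d)
    (h : ∀ j ≤ d, (finSuccEquiv K n f).coeff j = 0) : f = 0 := by
  apply (finSuccEquiv K n).injective
  rw [map_zero]
  refine Polynomial.ext fun j => ?_
  rw [Polynomial.coeff_zero]
  by_cases hj : j ≤ d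
  · exact h j hj
  · exact coeff_finSuccEquiv_eq_zero_of_lt hf (not_le.mp hj)

/-- The form with prescribed coefficients: `Σ_j g_j X_0^j` (`g_j ∈ S`, included via `X_i ↦ X_{i+1}`). [folklore] -/
theorem coeff_finSuccEquiv_sum_rename_mul_X_pow {d : ℕ} (g : Fin (d + 1) → MvPolynomial (Fin n) K) (j : Fin (d + 1)) :
    (finSuccEquiv K n (∑ i : Fin (d + 1), rename Fin.succ (g i) * X 0 ^ (i : ℕ))).coeff j = g j := by
  rw [map_sum, Polynomial.finsetSum_coeff]
  simp_rw [map_mul, map_pow, finSuccEquiv_X_zero, finSuccEquiv_rename_succ, Polynomial.coeff_C_mul_X_pow]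
  rw [Finset.sum_eq_single j]
  · rw [if_pos rfl]
  · intro i _ hij
    rw [if_neg (fun h => hij (Fin.ext h.symm))]
  · intro h
    exact absurd (Finset.mem_univ j) h

/-- `Σ_j g_j X_0^j` is a form of degree `d` when `g_j` is a form of degree `d - j`. [folklore] -/
theorem isHomogeneous_sum_rename_mul_X_pow {d : ℕ} {g : Fin (d + 1) → MvPolynomial (Fin n) K}
    (hg : ∀ j, (g j).IsHomogeneous (d - j)) :
    (∑ i : Fin (d + 1), rename Fin.succ (g i) * X (0 : Fin (n + 1)) ^ (i : ℕ)).IsHomogeneous d := by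
  refine IsHomogeneous.sum _ _ _ fun i _ => ?_
  have h1 : (rename Fin.succ (g i) : MvPolynomial (Fin (n + 1)) K).IsHomogeneous (d - i) :=
    (hg i).rename_isHomogeneous
  have h2 : ((X (0 : Fin (n + 1)) : MvPolynomial (Fin (n + 1)) K) ^ (i : ℕ)).IsHomogeneous (i : ℕ) :=
    isHomogeneous_X_pow (R := K) (0 : Fin (n + 1)) i
  have h := h1.mul h2
  have hi : (i : ℕ) ≤ d := Nat.lt_succ_iff.mp i.2
  rwa [Nat.sub_add_cancel hi] at h

/-- The `j`-th `X_0`-coefficient as a `k`-linear map `S' → S`. [folklore] -/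
theorem exists_linearMap_coeff_finSuccEquiv (j : ℕ) :
    ∃ L : MvPolynomial (Fin (n + 1)) K →ₗ[K] MvPolynomial (Fin n) K,
      ∀ f, L f = (finSuccEquiv K n f).coeff j :=
  ⟨((Polynomial.lcoeff (MvPolynomial (Fin n) K) j).restrictScalars K).comp
    (finSuccEquiv K n : MvPolynomial (Fin (n + 1)) K →ₐ[K] Polynomial (MvPolynomial (Fin n) K)).toLinearMap,
    fun _ => rfl⟩

/-! ## `dim S'_d = Σ_{j ≤ d} dim S_{d-j}` and `dim (I S')_d = Σ_{j ≤ d} dim I_{d-j}` -/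

/-- **`S'_d ≅ Π_{j ≤ d} S_{d-j}`** via the `X_0`-coefficients, on dimensions. [folklore] -/
theorem finrank_homogeneousSubmodule_succ_eq_sum (d : ℕ) :
    Module.finrank K (homogeneousSubmodule (Fin (n + 1)) K d) =
      ∑ j : Fin (d + 1), Module.finrank K (homogeneousSubmodule (Fin n) K (d - j)) := by
  haveI : ∀ j : Fin (d + 1), Module.Finite K (homogeneousSubmodule (Fin n) K (d - (j : ℕ))) :=
    fun j => Module.Finite.iff_fg.mpr (homogeneousSubmodule_fg (Fin n) K _)
  choose L hL using fun j : ℕ => exists_linearMap_coeff_finSuccEquiv (K := K) (n := n) j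
  let Φ : homogeneousSubmodule (Fin (n + 1)) K d →ₗ[K]
      (Π j : Fin (d + 1), homogeneousSubmodule (Fin n) K (d - j)) :=
    LinearMap.pi fun j : Fin (d + 1) => LinearMap.codRestrict (homogeneousSubmodule (Fin n) K (d - (j : ℕ)))
      ((L j).comp (Submodule.subtype (homogeneousSubmodule (Fin (n + 1)) K d)))
      fun f => (mem_homogeneousSubmodule _ _).mpr (by
        rw [LinearMap.comp_apply, hL]
        exact isHomogeneous_coeff_finSuccEquiv ((mem_homogeneousSubmodule _ _).mp f.2)
          (Nat.lt_succ_iff.mp j.2))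
  have hΦ : ∀ (f : homogeneousSubmodule (Fin (n + 1)) K d) (j : Fin (d + 1)),
      (Φ f j : MvPolynomial (Fin n) K) = (finSuccEquiv K n (f : MvPolynomial (Fin (n + 1)) K)).coeff j :=
    fun f j => hL j _
  have hbij : Function.Bijective Φ := by
    refine ⟨fun f g hfg => ?_, fun g => ?_⟩
    · apply Subtype.ext
      rw [← sub_eq_zero]
      refine eq_zero_of_coeff_finSuccEquiv_eq_zero (d := d)
        ((mem_homogeneousSubmodule _ _).mp (f - g).2) fun j hj => ?_
      have h := congrArg (fun v => (v ⟨j, Nat.lt_succ_iff.mpr hj⟩ : MvPolynomial (Fin n) K)) hfg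
      simp only [hΦ] at h
      rw [map_sub, Polynomial.coeff_sub, sub_eq_zero]
      exact h
    · refine ⟨⟨∑ i : Fin (d + 1), rename Fin.succ (g i : MvPolynomial (Fin n) K) * X 0 ^ (i : ℕ),
        (mem_homogeneousSubmodule _ _).mpr (isHomogeneous_sum_rename_mul_X_pow fun j =>
          (mem_homogeneousSubmodule _ _).mp (g j).2)⟩, ?_⟩
      funext j
      apply Subtype.ext
      rw [hΦ]
      exact coeff_finSuccEquiv_sum_rename_mul_X_pow _ j
  rw [(LinearEquiv.ofBijective Φ hbij).finrank_eq, Module.finrank_pi_fintype K]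

/-- **`(I S')_d ≅ Π_{j ≤ d} I_{d-j}`** via the `X_0`-coefficients, on dimensions. [folklore] -/
theorem finrank_idealDegree_map_rename_succ_eq_sum (I : Ideal (MvPolynomial (Fin n) K)) (d : ℕ) :
    Module.finrank K (idealDegree (I.map ((rename Fin.succ : MvPolynomial (Fin n) K →ₐ[K] MvPolynomial (Fin (n + 1)) K) :
      MvPolynomial (Fin n) K →+* MvPolynomial (Fin (n + 1)) K)) d) =
      ∑ j : Fin (d + 1), Module.finrank K (idealDegree I (d - j)) := by
  haveI : ∀ j : Fin (d + 1), Module.Finite K (idealDegree I (d - (j : ℕ))) := fun j => by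
    haveI : Module.Finite K (homogeneousSubmodule (Fin n) K (d - (j : ℕ))) :=
      Module.Finite.iff_fg.mpr (homogeneousSubmodule_fg (Fin n) K _)
    exact Submodule.finiteDimensional_of_le (idealDegree_le_homogeneousSubmodule I _)
  choose L hL using fun j : ℕ => exists_linearMap_coeff_finSuccEquiv (K := K) (n := n) j
  let Φ : idealDegree (I.map ((rename Fin.succ : MvPolynomial (Fin n) K →ₐ[K] MvPolynomial (Fin (n + 1)) K) :
      MvPolynomial (Fin n) K →+* MvPolynomial (Fin (n + 1)) K)) d →ₗ[K]
      (Π j : Fin (d + 1), idealDegree I (d - j)) :=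
    LinearMap.pi fun j : Fin (d + 1) => LinearMap.codRestrict (idealDegree I (d - (j : ℕ)))
      ((L j).comp (Submodule.subtype (idealDegree (I.map ((rename Fin.succ : MvPolynomial (Fin n) K →ₐ[K] MvPolynomial (Fin (n + 1)) K) :
      MvPolynomial (Fin n) K →+* MvPolynomial (Fin (n + 1)) K)) d)))
      fun f => by
        have hf : (f : MvPolynomial (Fin (n + 1)) K) ∈ idealDegree (I.map ((rename Fin.succ : MvPolynomial (Fin n) K →ₐ[K] MvPolynomial (Fin (n + 1)) K) :
      MvPolynomial (Fin n) K →+* MvPolynomial (Fin (n + 1)) K)) d := f.2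
        rw [LinearMap.comp_apply, hL]
        exact ⟨(mem_map_rename_succ_iff I _).mp hf.1 j,
          isHomogeneous_coeff_finSuccEquiv hf.2 (Nat.lt_succ_iff.mp j.2)⟩
  have hΦ : ∀ (f : idealDegree (I.map ((rename Fin.succ : MvPolynomial (Fin n) K →ₐ[K] MvPolynomial (Fin (n + 1)) K) :
      MvPolynomial (Fin n) K →+* MvPolynomial (Fin (n + 1)) K)) d) (j : Fin (d + 1)),
      (Φ f j : MvPolynomial (Fin n) K) = (finSuccEquiv K n (f : MvPolynomial (Fin (n + 1)) K)).coeff j :=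
    fun f j => hL j _
  have hbij : Function.Bijective Φ := by
    refine ⟨fun f g hfg => ?_, fun g => ?_⟩
    · apply Subtype.ext
      rw [← sub_eq_zero]
      refine eq_zero_of_coeff_finSuccEquiv_eq_zero (d := d) (f - g).2.2 fun j hj => ?_
      have h := congrArg (fun v => (v ⟨j, Nat.lt_succ_iff.mpr hj⟩ : MvPolynomial (Fin n) K)) hfg
      simp only [hΦ] at h
      rw [map_sub, Polynomial.coeff_sub, sub_eq_zero]
      exact h
    · have hmem : (∑ i : Fin (d + 1), rename Fin.succ (g i : MvPolynomial (Fin n) K) * X 0 ^ (i : ℕ)) ∈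
          idealDegree (I.map ((rename Fin.succ : MvPolynomial (Fin n) K →ₐ[K] MvPolynomial (Fin (n + 1)) K) :
      MvPolynomial (Fin n) K →+* MvPolynomial (Fin (n + 1)) K)) d := by
        refine ⟨(mem_map_rename_succ_iff I _).mpr fun j => ?_,
          isHomogeneous_sum_rename_mul_X_pow fun j => (g j).2.2⟩
        by_cases hj : j ≤ d
        · rw [coeff_finSuccEquiv_sum_rename_mul_X_pow (fun i => (g i : MvPolynomial (Fin n) K))
            ⟨j, Nat.lt_succ_iff.mpr hj⟩]
          exact (g _).2.1
        · rw [coeff_finSuccEquiv_eq_zero_of_lt (isHomogeneous_sum_rename_mul_X_pow fun j => (g j).2.2)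
            (not_le.mp hj)]
          exact zero_mem _
      refine ⟨⟨_, hmem⟩, ?_⟩
      funext j
      apply Subtype.ext
      rw [hΦ]
      exact coeff_finSuccEquiv_sum_rename_mul_X_pow _ j
  rw [(LinearEquiv.ofBijective Φ hbij).finrank_eq, Module.finrank_pi_fintype K]

/-! ## The Hilbert function -/

/-- **`H(S'/I S')(d) = Σ_{i ≤ d} H(S/I)(i)`: the Hilbert function of `A[T]` is `H^{(1)}(A)`**
(CJS (2.6) / Lemma 2.37 (1) for one variable; Rem. 2.9 (c)). [cite: CossartJannsenSaito2020, Lemma 2.27 (2)] -/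
theorem hilbertFunQuot_map_rename_succ (I : Ideal (MvPolynomial (Fin n) K)) (d : ℕ) :
    hilbertFunQuot K (n + 1) (I.map ((rename Fin.succ : MvPolynomial (Fin n) K →ₐ[K] MvPolynomial (Fin (n + 1)) K) :
      MvPolynomial (Fin n) K →+* MvPolynomial (Fin (n + 1)) K)) d =
      ∑ i ∈ Finset.range (d + 1), hilbertFunQuot K n I i := by
  unfold hilbertFunQuot
  rw [finrank_homogeneousSubmodule_succ_eq_sum, finrank_idealDegree_map_rename_succ_eq_sum,
    ← Finset.sum_tsub_distrib _ (fun j _ => finrank_idealDegree_le I _),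
    Fin.sum_univ_eq_sum_range (fun j => Module.finrank K (homogeneousSubmodule (Fin n) K (d - j)) -
      Module.finrank K (idealDegree I (d - j))) (d + 1)]
  have h := Finset.sum_range_reflect (fun i => Module.finrank K (homogeneousSubmodule (Fin n) K i) -
      Module.finrank K (idealDegree I i)) (d + 1)
  rw [← h]
  refine Finset.sum_congr rfl fun i _ => ?_
  rw [Nat.add_sub_cancel]

end Literature.RingTheory.MvPolynomial

end
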